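import Summits.BirchSwinnertonDyer.BirchSwinnertonDyer.Theses.ManinLocalTwoThree
import Summits.BirchSwinnertonDyer.BirchSwinnertonDyer.Theses.TwistFamilyManinDescent
import Summits.BirchSwinnertonDyer.BirchSwinnertonDyer.Theorems.ManinLocalTwoThreeManinPrimeToAdditiveFiveLeOptimalPartner
import Summits.BirchSwinnertonDyer.BirchSwinnertonDyer.Theorems.ManinLocalTwoThreeManinPrimeToAdditiveFiveLeStrongIsUnstarredOfAcrossIsogeny
import Summits.BirchSwinnertonDyer.BirchSwinnertonDyer.Theorems.ManinLocalTwoThreeManinPrimeToAdditiveFiveLeLedgerFivePrints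
import Summits.BirchSwinnertonDyer.BirchSwinnertonDyer.Theorems.ManinLocalTwoThreeManinPrimeToAdditiveFiveLeLedgerFourPrints
import Summits.BirchSwinnertonDyer.BirchSwinnertonDyer.Theorems.ManinLocalTwoThreeManinPrimeToAdditiveFiveLeLedgerFourPrintsNoDD
import Summits.BirchSwinnertonDyer.BirchSwinnertonDyer.Theorems.TwistFamilyManinDescentOrdinaryCornerOfSerreTateDepth
import Summits.BirchSwinnertonDyer.BirchSwinnertonDyer.Theorems.ManinLocalTwoThreeManinPrimeToAdditiveFiveLeNotBottomOfHorocyclic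
import Summits.BirchSwinnertonDyer.BirchSwinnertonDyer.Theorems.ManinLocalTwoThreeManinPrimeToAdditiveFiveLeCOneIffHorocyclic
import Summits.BirchSwinnertonDyer.BirchSwinnertonDyer.Theorems.ManinLocalTwoThreeManinPrimeToAdditiveFiveLeOrdinaryCornerOffTable
import Summits.BirchSwinnertonDyer.Rank1Residual.Additive.TypeGRamification
import Summits.BirchSwinnertonDyer.Rank1Residual.Additive.TypeGIntegralJ
import Summits.BirchSwinnertonDyer.Rank1Residual.Additive.GordIsogenyInvarianceClasses
import Mathlib.AlgebraicGeometry.EllipticCurve.LFunction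
import Mathlib.RepresentationTheory.Basic
import Mathlib.Data.Sym.Sym2
import Mathlib.LinearAlgebra.Matrix.GeneralLinearGroup.Defs
import HarnessLib

/-!
# Crux `ManinPrimeToAdditiveFiveLe` (stmt-BirchSwinnertonDyer-22969) — line `horocyclic-orientation`, skeleton v4
# (ideator bsd-idea-8, generation 8, lens «nearmiss», 2026-08-28; PREPARED in the seat's HOME for generation 9 to publish — W-71: one
# published skeleton per item per generation, and v3 is generation 8's). NOT the line of record (that is `Lines/upper_anchor.lean` v16,
# LEAD prover-bsd-line-ml23-c5-p1); publish with `ledger crux write` only (W-79). BSD is not proved by any of this; C5 is not proved; no leaf is.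

v4 = v3 REBASED onto the record's v16 composition + ONE new theorem-shaped observation: the SAME six typed inputs of Theorem R⁺ decide the
SECOND not-bottom leaf of C5, route `TwistFamilyManinDescent`'s C1 `EisensteinOrdinaryTwistLatticeNotBottom` (stmt-25939, `p ≥ 11`), and they do so
with a GENERIC Lemma W and WITHOUT the residue obstruction.
* The width seat's dictionary `Theorems.eisensteinOrdinaryTwistLatticeNotBottom_iff_horocyclicWitnesses` (p638660) makes C1 EQUIVALENT to horocyclic
  witnesses on the C1 rows (additive, `W[p]` reducible, (G)-ordinary, unstarred `v = v_p Δ_min ≤ 4`, `X₀`-optimal). On them `v ∈ {2,3,4}` (Kodaira list,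
  `padicValInt_minimalDiscriminantInt_mem_of_addv_of_padicValRat_j_nonneg` + `padicValRat_j_nonneg_of_typeGOrd`), `e = 12/gcd(12,v) ∈ {6,4,3}` divides
  `p − 1 = e·m` ((G): `typeG_iff_not_subM_and_semistabilityIndex_dvd`), and `κ = κ₀ = m`.
* `rowsCOne_arith` (sorry-free, ALL such `p` at once): the side conditions `(p−1)/2 ≤ p−m−1`, `2m+3 ≤ p` and LEMMA W's clash
  `{1−m, m} ≠ {−m, m+1}` in `ZMod (e·m)` (`sym2_clash`: `1 ≢ 0`, and `m ≡ −m` would give `em ∣ 2m`, `e ∣ 2`). So `uDeep_of_inputs` (v3, unchanged) runs on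
  the C1 rows: `horocyclicCOne_of_inputs : HorocyclicCohomologicalInputsCOne → (witnesses)`, `cOne_of_horocyclicInputs : … → C1` (through p638660).
* RESIDUE-FREE: on the C1 rows `κ₀ = (p−1)/e ≥ 2` (`p ≥ 13`; no rows at `p = 11`), so `σ_bad^∨ = Sym^{2κ₀}⊗det^{−κ₀}` has `2κ₀ ≠ 2` and Lemma C
  (`H²(SL₂(𝔽_p), Sym^r⊗det^b) = 0`, `1 ≤ r ≤ p−2`, `r ≠ 2`) kills the transgression: the five-term step needs Lemma HS only — Lemma B (the desk-proved
  joint of the `𝟙⊕ω` residue at `(5;3)`, `(7;2)`) is NOT on C1's path. The C1 rows are the CLEAN case of the lever.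
* REBASE: the composition is now the record's (v16) `maninPrimeToAdditiveFiveLe_of_fourPrints_of_sevenLeaves` (width seat -w2, p640646: C5 BY NAME ⟸ the
  four prints {Kato F″, Edixhoven Thm. 3 Kodaira half, ordinarity half, Mazur's `j`-list} ∧ the seven leaves), with TWO of the seven leaves THEOREMS of this
  line's inputs: K18b″ `OrdinaryCornerDeepUnstarredNotBottom` (27662) := `stub_notBottom_of_horocyclic57 horocyclic57` (v3; the support CLOSED p637599) and
  C1 (25939) := `notBottom13 = cOne_of_horocyclicInputs stub_horocyclicInputsCOne` (v4). The v12-era chain of v1–v3 (`stub_acrossIsogeny57`,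
  `stub_ordinaryTwistLaw13`, `red57…`, `degreeUp13…`) is dropped — the alternative book at 13 is kept only as the theorem
  `ManinPrimeToAdditiveFiveLe_of_ordinaryTwistLaw13 (hO13)`.

STUBS (7 = stubs_max; sorries only inside them): `stub_printedInputs` [4 cite-only Literature facts; NOT a prover target] · `stub_ss57` [K15b 27071] ·
`stub_strongIsUnstarred57` [K15a 27072] · `stub_deepInputs18R` [I9 27660 ∧ K18a″ 27661] · `stub_strongIsTop13` [C2 26929] — all BY NAME, owned by route
`TwistFamilyManinDescent` — and THIS LINE's two: `stub_horocyclicInputs57 : HorocyclicCohomologicalInputs` [⟹ K18b″ 27662] and `stub_horocyclicInputsCOne :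
HorocyclicCohomologicalInputsCOne` [⟹ C1 25939]: on every H57 / C1 row the genuine mod-`p` cohomological realisation datum of `f_W` (`HoroData`, memo §1,
definition request D-H1 — head start `HoroSketch.rhoH` over Mathlib's `groupCohomology.H1`/`map`, seat HOME `lines/horoH_dh1_sketch.lean`) EXISTS and
satisfies `LocalModelCaseA`, `InertiaExponent`, `WeightsOfLevelM`, `HSFiveTermNatural`, `Interiority`, `HorocyclicDictionary`.
HONEST READING (unchanged): as closed `Prop`s over a posited interface the two input statements are NOT WEAKER than H57 / the C1 witnesses (a junk case-A
datum reduces them to the conclusion); what the skeleton buys is the kernel-checked proof plan of R⁺ between six separately groundable, print-sourced,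
lemma-shaped facts about ONE construction — now for BOTH not-bottom leaves, with the generic-`p` Lemma W in Lean. New «why it might fail» specific to v4:
the sign of `InertiaExponent` at `p ≥ 11` rests on the §4 derivation alone (the instrument `horodepth.py` was run at `p ∈ {5,7}` only; extending the
critic's P2 sweep to `p ∈ {13, 17, 19}`, `e ∣ p − 1`, `p² ∣ N`, is the cheapest falsifier of `stub_horocyclicInputsCOne`).

Carried verbatim from v3 (see the v3 header in the tree history, commit 36ed1f229113): the interface `HoroData`, the six predicates, `uDeep_of_inputs`,
`rows57_arith`, `horocyclic57_of_inputs`, the v2 rung statements (`HorocyclicDepthDichotomy`, `HorocyclicExactDepthLaw`, `IrreducibleRowsHorocyclicDepth`,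
`HorocyclicOffResidue`, `HorocyclicResidualAvoidance`, glue `horocyclic57_of_offResidue_of_residualAvoidance`), the crux-decl `OrdinaryCornerDeepUnstarredHorocyclic`
(H57) and `horocyclicDifference`. Desk memo `Lines/horocyclic-orientation-desk.md` (rev 3), card `Lines/horocyclic-orientation.md`, idea `Ideas/horocyclic-orientation.md`.
-/


set_option autoImplicit false
set_option linter.dupNamespace false

noncomputable section

open scoped Classical NumberField

open WeierstrassCurve IsDedekindDomain NumberField Literature.NumberTheory.EllipticCurves
  Literature.NumberTheory.EllipticCurves.ModularForms Literature.NumberTheory.EllipticCurves.Rank1Residual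
  Summit.BirchSwinnertonDyer.Rank1Residual.ManinAdditive Summit.BirchSwinnertonDyer.Rank1Residual.Additive
  Summit.BirchSwinnertonDyer.BirchSwinnertonDyer.Theses.EdixhovenFibreFiveSeven
  Summit.BirchSwinnertonDyer.BirchSwinnertonDyer.Theorems

namespace Summit.BirchSwinnertonDyer.BirchSwinnertonDyer.Cruxes.ManinPrimeToAdditiveFiveLe.HorocyclicOrientation

/-- v3 STUB 1 — CLOSED (p606476, width seat): the commuting optimal `p*`-partner. Kept for the record;
not used by the composition since v4. [cite: Watkins2002, §2.1] -/
theorem stub_optimalPartner :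
    exists_isNewformOf →
    ∀ {p : ℕ}, p.Prime → 5 ≤ p →
    ∀ (W : WeierstrassCurve ℚ) [W.IsElliptic] [W.IsGloballyMinimal] [NeZero (W.conductorNorm ℤ)]
      (D : ModularParametrizationData W (W.conductorNorm ℤ)),
      IsLatticeOptimal D → p ^ 2 ∣ W.conductorNorm ℤ →
      ¬ (∃ (W' : WeierstrassCurve ℚ), W'.IsElliptic ∧ W'.IsGloballyMinimal ∧
          IsIsogenous W (W'.quadraticTwist (((-1 : ℤ) ^ (p / 2) * p : ℤ) : ℚ)) ∧
          ¬ p ^ 2 ∣ W'.conductorNorm ℤ) →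
      W.HasIrreducibleModPGaloisRep p →
      ∃ (W' : WeierstrassCurve ℚ) (_ : W'.IsElliptic) (_ : W'.IsGloballyMinimal)
        (_ : NeZero (W'.conductorNorm ℤ)) (u : VariableChange ℚ)
        (D' : ModularParametrizationData W' (W'.conductorNorm ℤ)),
        IsLatticeOptimal D' ∧ W'.conductorNorm ℤ = W.conductorNorm ℤ ∧
        u • W.quadraticTwist ((((-1 : ℤ) ^ (p / 2) * p : ℤ)) : ℚ) = W' :=
  -- CLOSED (width seat -w2, p606476): tree theorem, verbatim signature
  Summit.BirchSwinnertonDyer.BirchSwinnertonDyer.Theorems.stub_optimalPartner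

/-- STUB P — **the printed inputs** (FOUR cite-only Literature facts as ONE conjunction; NOT a prover target — each conjunct is a
statement-only `def … : Prop` that closes only by an XL `_holds` port under `Literature/`). v16: D–D 2015 Thm. 5.1 (1) LEAVES (a THEOREM on the
(G)-locus, -w2 p639486); v14: ČNS Thm. 1.2 and Cremona's table LEFT; v13: Gealy–Klagsbrun LEFT. Conjuncts: Kato F″
`kato_neron_isIntegral_twistedSymbolSum_of_additive_five_le` (Kato (8.1.3)/9.7/6.6 + Kim–Nakamura 2.4 + Kosters–Pannekoek Thm 1,
referee-flagged derived reading), Edixhoven 1991 Thm 3 (Kodaira half, ordinarity half), Mazur 1978 Thm 1 with the rational points of `X₀(p)`.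
[cite: Kato2004Asterisque, (8.1.3) (p. 180), Thm. 9.7 (p. 189)] [cite: EdixhovenManin1991, Thm. 3] [cite: Mazur1978, Thm. 1] -/
theorem stub_printedInputs :
    kato_neron_isIntegral_twistedSymbolSum_of_additive_five_le ∧
    edixhoven_not_dvd_maninConstant_of_kodairaSymbol_ne ∧
    edixhoven_not_dvd_maninConstant_of_not_potentiallyGoodOrdinary ∧
    mazur_j_mem_of_not_hasIrreducibleModPGaloisRep_of_eleven_le := by
  sorry


/-- The **horocyclic `k`-th difference** (`k = (p−1)/2`) of the modular symbol of `f` at the cusp `A/C`, step `1/p`: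
`Δ^k_{1/p}{∞, A/C}_f := Σ_{i=0}^{k} (−1)^i·C(k,i)·{∞, A/C + i/p}_f`. For `γ = (A B; C D) ∈ Γ₀(N)` with `p² ∣ N ∣ C` and
`A ≡ D (mod p)` every term is the period `{∞, (u_i γ u_i⁻¹)∞}_f ∈ Λ_f`, `u_i = (1 i/p; 0 1)`. -/
def horocyclicDifference {N : ℕ} (f : CuspForm (CongruenceSubgroup.Gamma0 N) 2) (p : ℕ) (A C : ℤ) : ℂ :=
  ∑ i ∈ Finset.range ((p - 1) / 2 + 1),
    ((((-1 : ℤ) ^ i * (((p - 1) / 2).choose i : ℕ)) : ℤ) : ℂ) *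
      modularSymbol f ((A : ℚ) / (C : ℚ) + (i : ℚ) / (p : ℚ))

/-- CRUX of the line «horocyclic-orientation» — `OrdinaryCornerDeepUnstarredHorocyclic` («the unstarred deep optimal form is
`u`-DEEP»): on the rows of K18b″ `OrdinaryCornerDeepUnstarredNotBottom` (stmt-27662: `(5; v₅Δ = 3)`, `(7; v₇Δ ∈ {2,4})`, `p² ∣ N`,
`W[p]` reducible, `W ⊗ p*` additive, lattice-optimal datum, Serre–Tate-deep) there is `γ = (A *; C *) ∈ Γ₀(N)` with
`A ≡ D ≡ ±1 (mod p)` whose horocyclic `(p−1)/2`-th difference `Δ^k_{1/p}{∞, γ∞}_{f_W}` is NOT in `p·Λ_{f_W}`; equivalently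
`(u*−1)^{(p−1)/2} Φ̄_{f_W} ≠ 0` in `H¹(X_H(p²M); 𝔽_p)`; equivalently the mod-`p` modular symbol of `f_W` is not a polynomial of degree
`< (p−1)/2` along the horocycles `{γ∞ + j/p}`. EQUIVALENT on these rows to ¬BOTTOM (27662) by `stub_notBottom_of_horocyclic57` and its
(unfiled) converse; instrument 12/12 (6 unstarred TOP-type, 6 starred BOTTOM-type). Why it might fail: it is Edixhoven's open case 1 in
new clothes — a `u`-shallow unstarred optimal deep curve beyond the instrument's range (= an orbit with `c = p`) refutes it; the proposed
mechanism (Hecke-stable `u`-filtration, `gr_i ≅ gr_0 ⊗ ω̄^{−i}`, Serre-weight / Borel-restriction analysis of `H¹(X(p)M;𝔽_p)[𝔪]`)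
needs mod-`p` multiplicity information at an EISENSTEIN maximal ideal of level `Γ₁(p)M`, in print only in parts (Ohta, Lafferty,
Wake–Wang-Erickson); for irreducible `W[p]` it is Emerton's local–global compatibility. [cite: EdixhovenManin1991, §4]
[cite: MazurTateTeitelbaum1986Invent, §I.8] [cite: Shimura1971, Prop. 3.64] -/
def OrdinaryCornerDeepUnstarredHorocyclic : Prop :=
  ∀ (W : WeierstrassCurve ℚ) [W.IsElliptic] [W.IsGloballyMinimal] (p : ℕ) [Fact p.Prime]
    [NeZero (W.conductorNorm ℤ)] (D : ModularParametrizationData W (W.conductorNorm ℤ))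
    (_hsq : p ^ 2 ∣ W.conductorNorm ℤ),
    ((p = 5 ∧ padicValInt 5 W.minimalDiscriminantInt = 3) ∨
      (p = 7 ∧ padicValInt 7 W.minimalDiscriminantInt ∈ ({2, 4} : Finset ℕ))) →
    ¬ W.HasIrreducibleModPGaloisRep p →
    ¬ ((W.quadraticTwist (((-1 : ℤ) ^ (p / 2) * p : ℤ) : ℚ)).HasGoodReductionAt
          ((Rat.HeightOneSpectrum.primesEquiv (R := ℤ)).symm ⟨p, Fact.out⟩) ∨
       (W.quadraticTwist (((-1 : ℤ) ^ (p / 2) * p : ℤ) : ℚ)).HasMultiplicativeReductionAt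
          ((Rat.HeightOneSpectrum.primesEquiv (R := ℤ)).symm ⟨p, Fact.out⟩)) →
    (∀ z ∈ D.L.lattice, ∃ w ∈ periodLattice D.f, z = D.c * w) →
    ((p = 5 → (3 : ℤ) ≤ padicValRat 5 (W.j - 1728)) ∧ (p = 7 → (4 : ℤ) ≤ padicValRat 7 W.j)) →
    ∃ (A C : ℤ), (W.conductorNorm ℤ : ℤ) ∣ C ∧ 0 < C ∧ IsCoprime A C ∧ (p : ℤ) ∣ A * A - 1 ∧
      ¬ ∃ y ∈ periodLattice D.f, horocyclicDifference D.f p A C = (p : ℂ) * y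

/-- v2. The horocyclic difference of ORDER `n` (step `1/p`) of the modular symbol of `f` at `A/C`:
`Δ^n_{1/p}{∞, A/C}_f := Σ_{i=0}^{n} (−1)^i·C(n,i)·{∞, A/C + i/p}_f`; `horocyclicDifference = horocyclicDiff … ((p−1)/2)`. -/
def horocyclicDiff {N : ℕ} (f : CuspForm (CongruenceSubgroup.Gamma0 N) 2) (p n : ℕ) (A C : ℤ) : ℂ :=
  ∑ i ∈ Finset.range (n + 1),
    ((((-1 : ℤ) ^ i * ((n.choose i : ℕ) : ℤ)) : ℤ) : ℂ) *
      modularSymbol f ((A : ℚ) / (C : ℚ) + (i : ℚ) / (p : ℚ))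

theorem horocyclicDifference_eq_horocyclicDiff {N : ℕ} (f : CuspForm (CongruenceSubgroup.Gamma0 N) 2) (p : ℕ) (A C : ℤ) :
    horocyclicDifference f p A C = horocyclicDiff f p ((p - 1) / 2) A C := rfl

/-- v2. «The mod-`p` modular symbol of `f` (level `N`) has `u`-DEPTH EXACTLY `d` along the admissible horocycles»: some order-`(d−1)`
difference `Δ^{d−1}_{1/p}{∞, A/C}_f` (`N ∣ C > 0`, `gcd(A,C) = 1`, `A ≡ ±1 (mod p)`, so that every term is a period in `Λ_f`) is NOT in
`p·Λ_f`, and every order-`d` difference IS. (Dictionary, desk memo §1: `d` = least `d` with `(u*−1)^d Φ̄_f = 0` in `H¹(X_H(p²M);𝔽_p)`,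
`u = (1 1/p; 0 1)`, `H = {±1}`.) -/
def HasHorocyclicDepth {N : ℕ} (f : CuspForm (CongruenceSubgroup.Gamma0 N) 2) (p d : ℕ) : Prop :=
  (∃ (A C : ℤ), (N : ℤ) ∣ C ∧ 0 < C ∧ IsCoprime A C ∧ (p : ℤ) ∣ A * A - 1 ∧
      ¬ ∃ y ∈ periodLattice f, horocyclicDiff f p (d - 1) A C = (p : ℂ) * y) ∧
  (∀ (A C : ℤ), (N : ℤ) ∣ C → 0 < C → IsCoprime A C → (p : ℤ) ∣ A * A - 1 →
      ∃ y ∈ periodLattice f, horocyclicDiff f p d A C = (p : ℂ) * y)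

/-- v2 SUPPORT (D) — `HorocyclicDepthDichotomy` (desk memo §3; elementary, ANY `W[p]`): on the potentially-ordinary rows
`(5; v ∈ {3,9})`, `(7; v ∈ {2,4,8,10})` with `p² ∣ N` put `κ := v(p−1)/12`, `κ₀ := min(κ, p−1−κ)`; then the `u`-depth of `Φ̄_{f_W}` is
EITHER `p − κ₀` (the cyclic `ℤ_p[GL₂(𝔽_p)]`-lattice generated by a coordinate class of `Φ_f` in `H¹(𝒴;ℤ_p)[𝔭_f]` is saturated; TOP)
OR `κ₀ + 1` (it is not; BOTTOM) — nothing in between. Proof in the memo: the `T(𝔽_p)`-fixed line of `Ind(ω̃^κ⊗ω̃^{−κ})`, its two lattice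
classes, finite differences of `x ↦ x^n` on `𝔽_p`. Formalisation needs the `GL₂(𝔽_p)`-module structure of `H¹(X(Γ(p)∩Γ₀(M)))` — size L as a
Lean target; stated here as the typed form the instrument tests (observed depths are only the predicted pairs). [cite: Shimura1971, Prop. 3.64]
[cite: MazurTateTeitelbaum1986Invent, §I.8] -/
def HorocyclicDepthDichotomy : Prop :=
  ∀ (W : WeierstrassCurve ℚ) [W.IsElliptic] [W.IsGloballyMinimal] (p : ℕ) [Fact p.Prime]
    [NeZero (W.conductorNorm ℤ)] (D : ModularParametrizationData W (W.conductorNorm ℤ))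
    (_hsq : p ^ 2 ∣ W.conductorNorm ℤ),
    ((p = 5 ∧ padicValInt 5 W.minimalDiscriminantInt ∈ ({3, 9} : Finset ℕ)) ∨
      (p = 7 ∧ padicValInt 7 W.minimalDiscriminantInt ∈ ({2, 4, 8, 10} : Finset ℕ))) →
    let κ := padicValInt p W.minimalDiscriminantInt * (p - 1) / 12
    HasHorocyclicDepth D.f p (p - min κ (p - 1 - κ)) ∨ HasHorocyclicDepth D.f p (min κ (p - 1 - κ) + 1)

/-- v2 SUPPORT (L) — `HorocyclicExactDepthLaw` (CONJECTURAL law; desk memo §0 (L)): on the same rows the `u`-depth of `Φ̄_{f_W}` is EXACTLY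
`p − v_p(Δ_min)(p−1)/12` (`(5;3) ↦ 4`, `(5;9) ↦ 2`, `(7;2) ↦ 6`, `(7;4) ↦ 5`, `(7;8) ↦ 3`, `(7;10) ↦ 2`); in particular TOP ⟺ `v < 6` ⟺
unstarred. Instrument rev 2: 18/18 (150a1, 175a1, 200b1, 450c1, 147c1, 294b1, 490k1, 637a1, 441b1 and their `p*`-twists). Desk-PROVED for
irreducible `W[p]` (`IrreducibleRowsHorocyclicDepth`) and for reducible `W[p]` off the residue (`HorocyclicOffResidue`); OPEN exactly on the
residue `κ₀ = 1 ∧ W[p]^{ss} ≅ 𝟙 ⊕ ω`. Why it might fail: a residual curve whose `Φ̄_f`-lattice meets the `SL₂(ℤ/p²)`-Eisenstein copy of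
`Sym²⊗det⁻¹` (memo §5 R′) has depth `2` instead of `p−1`. [cite: EdixhovenManin1991, §4] [cite: MazurTateTeitelbaum1986Invent, §I.8] -/
def HorocyclicExactDepthLaw : Prop :=
  ∀ (W : WeierstrassCurve ℚ) [W.IsElliptic] [W.IsGloballyMinimal] (p : ℕ) [Fact p.Prime]
    [NeZero (W.conductorNorm ℤ)] (D : ModularParametrizationData W (W.conductorNorm ℤ))
    (_hsq : p ^ 2 ∣ W.conductorNorm ℤ),
    ((p = 5 ∧ padicValInt 5 W.minimalDiscriminantInt ∈ ({3, 9} : Finset ℕ)) ∨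
      (p = 7 ∧ padicValInt 7 W.minimalDiscriminantInt ∈ ({2, 4, 8, 10} : Finset ℕ))) →
    HasHorocyclicDepth D.f p (p - padicValInt p W.minimalDiscriminantInt * (p - 1) / 12)

/-- v2 RUNG (I) — `IrreducibleRowsHorocyclicDepth` (critic V#59 P1: «type `IrreducibleRowsHorocyclic` in skeleton v2»): the exact law (L)
for IRREDUCIBLE `W[p]`. DESK-PROVED (memo §5 Thm I) from: the two lattice classes of the principal-series type `Ind(ω̃^κ⊗ω̃^{−κ})` and
their socles (`Sym^{p−1−2κ₀}⊗det^{κ₀}` vs `Sym^{2κ₀}⊗det^{−κ₀}`); the inertia shape `ρ̄_W|_{I_p} = (ω^{1−κ} ∗; 0 ω^{κ})`, `κ ≡ v(p−1)/12`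
(descent over `ℚ_p^{nr}(p^{1/e})`; Serre's `ω`); mod-`p` Eichler–Shimura (Ash–Stevens) + Deligne/Fontaine to see that the BOTTOM socle is
not a weight of `𝔪_f`; the Hochschild–Serre five-term sequence for `Γ(p)∩Γ₀(M) ⊲ Γ₀(M)`, whose only obstruction group
`H²(SL₂(𝔽_p), Sym^{2κ₀}⊗det^{−κ₀})` is `0` for `κ₀ ≥ 2` and carries the Eisenstein system `1+ℓ` for `κ₀ = 1` (restriction to the Borel;
the `SL₂(ℤ/p²)` class). P1's curves: 200b1 at 5 → depth 4 ≥ 3; 147c1 at 7 → depth 6 ≥ 4 (computed = derived). It is a witness of the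
MECHANISM in a regime where `p ∤ c` is already known (Mazur F″), not a new Manin statement. Why it might fail as typed: only through the
dictionary (admissible-cusp sampling of `H₁(X_H)`: the classes `{∞, γ∞}`, `γ ∈ Γ_H(N)`, generate, so a witness exists iff the class-level
depth is attained). [cite: EdixhovenManin1991, §4] [cite: Shimura1971, Prop. 3.64] -/
def IrreducibleRowsHorocyclicDepth : Prop :=
  ∀ (W : WeierstrassCurve ℚ) [W.IsElliptic] [W.IsGloballyMinimal] (p : ℕ) [Fact p.Prime]
    [NeZero (W.conductorNorm ℤ)] (D : ModularParametrizationData W (W.conductorNorm ℤ))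
    (_hsq : p ^ 2 ∣ W.conductorNorm ℤ),
    ((p = 5 ∧ padicValInt 5 W.minimalDiscriminantInt ∈ ({3, 9} : Finset ℕ)) ∨
      (p = 7 ∧ padicValInt 7 W.minimalDiscriminantInt ∈ ({2, 4, 8, 10} : Finset ℕ))) →
    W.HasIrreducibleModPGaloisRep p →
    HasHorocyclicDepth D.f p (p - padicValInt p W.minimalDiscriminantInt * (p - 1) / 12)

/-- v2. The RESIDUAL Eisenstein condition `W[p]^{ss} ≅ 𝟙 ⊕ ω`: `a_ℓ(W) ≡ 1 + ℓ (mod p)` for every prime `ℓ ∤ pN`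
(`a_ℓ(W) = W.LFunction ℓ`, Mathlib). On the unstarred `κ₀ = 1` rows this is exactly where the Hochschild–Serre obstruction line
(the `SL₂(ℤ/p²)`-class, Hecke system `1+ℓ`) is `𝔪_f`-relevant (memo §5). Instances: 150a1, 175a1 (`p=5`); 294b1, 490k1 (`p=7`);
NON-instances on the same rows: 450c1 (`χ₋₃⊗(𝟙⊕ω)`), 200b1, 147c1 (irreducible). -/
def IsOnePlusOmegaResidual (W : WeierstrassCurve ℚ) (p : ℕ) : Prop :=
  ∀ ℓ : ℕ, ℓ.Prime → ¬ (ℓ ∣ p * W.conductorNorm ℤ) → (p : ℤ) ∣ W.LFunction ℓ - ((ℓ : ℤ) + 1)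

/-- v2 SPLIT, half 1 — `HorocyclicOffResidue` (desk-PROVED part of H57, memo §5 Thm R; Lean size L): the crux
`OrdinaryCornerDeepUnstarredHorocyclic` on row `(7; v=4)` (`κ₀ = 2`: the obstruction group `H²(SL₂(𝔽_7), Sym⁴⊗det^{−2})` vanishes) and on
the rows `(5;3)`, `(7;2)` OFF the residue (`a_{ℓ₀}(W) ≢ 1+ℓ₀` for some `ℓ₀ ∤ pN`: `T_{ℓ₀} − a_{ℓ₀}` is invertible on the obstruction line).
Checked instances: 637a1 (depth 5), 450c1 (depth 4). Why it might fail: only via a gap in the desk proof (HS bookkeeping at torsion of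
`Γ₀(M)`; interior vs open cohomology — both addressed in the memo) — the mathematics is print-level. [cite: EdixhovenManin1991, §4]
[cite: Shimura1971, Prop. 3.64] -/
def HorocyclicOffResidue : Prop :=
  ∀ (W : WeierstrassCurve ℚ) [W.IsElliptic] [W.IsGloballyMinimal] (p : ℕ) [Fact p.Prime]
    [NeZero (W.conductorNorm ℤ)] (D : ModularParametrizationData W (W.conductorNorm ℤ))
    (_hsq : p ^ 2 ∣ W.conductorNorm ℤ),
    ((p = 5 ∧ padicValInt 5 W.minimalDiscriminantInt = 3) ∨
      (p = 7 ∧ padicValInt 7 W.minimalDiscriminantInt ∈ ({2, 4} : Finset ℕ))) →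
    ¬ W.HasIrreducibleModPGaloisRep p →
    ¬ ((W.quadraticTwist (((-1 : ℤ) ^ (p / 2) * p : ℤ) : ℚ)).HasGoodReductionAt
          ((Rat.HeightOneSpectrum.primesEquiv (R := ℤ)).symm ⟨p, Fact.out⟩) ∨
       (W.quadraticTwist (((-1 : ℤ) ^ (p / 2) * p : ℤ) : ℚ)).HasMultiplicativeReductionAt
          ((Rat.HeightOneSpectrum.primesEquiv (R := ℤ)).symm ⟨p, Fact.out⟩)) →
    (∀ z ∈ D.L.lattice, ∃ w ∈ periodLattice D.f, z = D.c * w) →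
    ((p = 5 → (3 : ℤ) ≤ padicValRat 5 (W.j - 1728)) ∧ (p = 7 → (4 : ℤ) ≤ padicValRat 7 W.j)) →
    ((p = 7 ∧ padicValInt 7 W.minimalDiscriminantInt = 4) ∨ ¬ IsOnePlusOmegaResidual W p) →
    ∃ (A C : ℤ), (W.conductorNorm ℤ : ℤ) ∣ C ∧ 0 < C ∧ IsCoprime A C ∧ (p : ℤ) ∣ A * A - 1 ∧
      ¬ ∃ y ∈ periodLattice D.f, horocyclicDifference D.f p A C = (p : ℂ) * y

/-- v2 SPLIT, half 2 — `HorocyclicResidualAvoidance` (THE RESIDUE R′ of H57 = the new hardest target; size XL): on the rows `(5;3)`, `(7;2)`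
with `W[p]^{ss} ≅ 𝟙⊕ω` (`IsOnePlusOmegaResidual`), reducible/additive-twist/optimal/deep as in the crux, the unstarred deep optimal form is
`u`-DEEP. Content (memo §5 R′): the mod-`p` lattice `Λ̄_f = (H¹(𝒴;ℤ_p)[𝔭_f])/p` does NOT contain the `SL₂(𝔽_p)`-equivariant
«`SL₂(ℤ/p²)`-Eisenstein» copy of `Sym²⊗det^{−1}` that EXISTS in `H¹(Γ(p)∩Γ₀(M);𝔽̄_p)_𝔪` (it maps onto the non-zero obstruction line
`H²(SL₂(𝔽_p),Ad)`, `d₂` being surjective as `H²(Γ₀(M),Ad⊗𝔽_p) = 0`); equivalently the cyclic `ℤ_p[GL₂(𝔽_p)]`-lattice of a coordinate class of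
`Φ_f` is saturated. Instrument: 150a1, 175a1, 294b1, 490k1 all depth `p−1` (4/4). Handles: interior-vs-open (boundary test of the copy at the
`p`-power cusps), `[𝔭_f]`-vs-`[𝔪]` (length of `H¹(𝒴;ℤ_p)_𝔪/𝔭_f`), level `p²` (the class dies on `SL₂(ℤ/p²)`). Why it might fail: it is
Edixhoven's case 1 concentrated on the `𝟙⊕ω` corner — a residual curve beyond the instrument's range whose lattice meets the copy (depth 2)
refutes it and the exact law with it. [cite: EdixhovenManin1991, §4] [cite: MazurTateTeitelbaum1986Invent, §I.8] -/
def HorocyclicResidualAvoidance : Prop :=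
  ∀ (W : WeierstrassCurve ℚ) [W.IsElliptic] [W.IsGloballyMinimal] (p : ℕ) [Fact p.Prime]
    [NeZero (W.conductorNorm ℤ)] (D : ModularParametrizationData W (W.conductorNorm ℤ))
    (_hsq : p ^ 2 ∣ W.conductorNorm ℤ),
    ((p = 5 ∧ padicValInt 5 W.minimalDiscriminantInt = 3) ∨
      (p = 7 ∧ padicValInt 7 W.minimalDiscriminantInt = 2)) →
    ¬ W.HasIrreducibleModPGaloisRep p →
    ¬ ((W.quadraticTwist (((-1 : ℤ) ^ (p / 2) * p : ℤ) : ℚ)).HasGoodReductionAt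
          ((Rat.HeightOneSpectrum.primesEquiv (R := ℤ)).symm ⟨p, Fact.out⟩) ∨
       (W.quadraticTwist (((-1 : ℤ) ^ (p / 2) * p : ℤ) : ℚ)).HasMultiplicativeReductionAt
          ((Rat.HeightOneSpectrum.primesEquiv (R := ℤ)).symm ⟨p, Fact.out⟩)) →
    (∀ z ∈ D.L.lattice, ∃ w ∈ periodLattice D.f, z = D.c * w) →
    ((p = 5 → (3 : ℤ) ≤ padicValRat 5 (W.j - 1728)) ∧ (p = 7 → (4 : ℤ) ≤ padicValRat 7 W.j)) →
    IsOnePlusOmegaResidual W p →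
    ∃ (A C : ℤ), (W.conductorNorm ℤ : ℤ) ∣ C ∧ 0 < C ∧ IsCoprime A C ∧ (p : ℤ) ∣ A * A - 1 ∧
      ¬ ∃ y ∈ periodLattice D.f, horocyclicDifference D.f p A C = (p : ℂ) * y

/-- v2 THEOREM (kernel-checked reduction): H57 = `HorocyclicOffResidue` ∧ `HorocyclicResidualAvoidance`. Case split on the row and on
`IsOnePlusOmegaResidual W p`. -/
theorem horocyclic57_of_offResidue_of_residualAvoidance
    (hOff : HorocyclicOffResidue) (hRes : HorocyclicResidualAvoidance) :
    OrdinaryCornerDeepUnstarredHorocyclic := by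
  intro W _ _ p _ _ D hsq hrow hred hadd hopt hdeep
  by_cases hE : IsOnePlusOmegaResidual W p
  · rcases hrow with ⟨hp5, hv⟩ | ⟨hp7, hv⟩
    · exact hRes W p D hsq (Or.inl ⟨hp5, hv⟩) hred hadd hopt hdeep hE
    · have hv' : padicValInt 7 W.minimalDiscriminantInt = 2 ∨ padicValInt 7 W.minimalDiscriminantInt = 4 := by
        simpa only [Finset.mem_insert, Finset.mem_singleton] using hv
      rcases hv' with hv2 | hv4
      · exact hRes W p D hsq (Or.inr ⟨hp7, hv2⟩) hred hadd hopt hdeep hE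
      · exact hOff W p D hsq (Or.inr ⟨hp7, hv⟩) hred hadd hopt hdeep (Or.inl ⟨hp7, hv4⟩)
  · exact hOff W p D hsq hrow hred hadd hopt hdeep (Or.inr hE)

/-! ## v3 (critic V#69 price P6): the proof skeleton of Theorem R⁺ (desk memo §5b) typed at INTERFACE level

One posited object (`HoroData`), six named hypothesis-predicates, one closed construction-∧-facts statement
(`HorocyclicCohomologicalInputs`, the new stub), and the sorry-free glue `uDeep_of_inputs` / `horocyclic57_of_inputs`. -/

/-- `κ(W,p) := v_p(Δ_min)·(p−1)/12` (desk memo §0): the étale inertia exponent of `W[p]` on the potentially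
ordinary additive rows (`e = 12/gcd(12,v) ∣ p − 1`); memo §4. -/
def kappa (W : WeierstrassCurve ℚ) [W.IsGloballyMinimal] (p : ℕ) : ℕ :=
  padicValInt p W.minimalDiscriminantInt * (p - 1) / 12

/-- `κ₀ := min(κ, p−1−κ)`; UNSTARRED `⟺ κ = κ₀` (memo §0). -/
def kappa0 (W : WeierstrassCurve ℚ) [W.IsGloballyMinimal] (p : ℕ) : ℕ := min (kappa W p) (p - 1 - kappa W p)

/-- `GL₂(𝔽_p)`. -/
abbrev GL2 (p : ℕ) : Type := Matrix.GeneralLinearGroup (Fin 2) (ZMod p)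

/-- A bundled `k`-linear representation of `GL₂(𝔽_p)` (interface-level carrier for `σ_{a,b} = Sym^a ⊗ det^b ⊗ k` and for
`H = H¹(𝒴; k)`). -/
structure GModule (k : Type) [Field k] (p : ℕ) : Type 1 where
  /-- carrier -/
  V : Type
  [instAddCommGroup : AddCommGroup V]
  [instModule : Module k V]
  /-- the `GL₂(𝔽_p)`-action -/
  ρ : Representation k (GL2 p) V

attribute [instance] GModule.instAddCommGroup GModule.instModule

/-- A bundled `k`-module with Hecke operators `T ℓ` (interface-level carrier for `H¹(Γ₀(M), σ_{a,b} ⊗ k)` with its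
Ash–Stevens Hecke operators, `ℓ ∤ pM`). -/
structure HeckeModule (k : Type) [Field k] : Type 1 where
  /-- carrier -/
  V : Type
  [instAddCommGroup : AddCommGroup V]
  [instModule : Module k V]
  /-- the Hecke operator `T_ℓ` (only `ℓ` prime, `ℓ ∤ pN` are ever used) -/
  T : ℕ → V →ₗ[k] V

attribute [instance] HeckeModule.instAddCommGroup HeckeModule.instModule

/-- «the mod-`p` Hecke eigensystem `χ` OCCURS in `L`»: a non-zero simultaneous eigenvector for the `T_ℓ`, `ℓ` prime, `ℓ ∤ Q`. -/
def HeckeModule.OccursIn {k : Type} [Field k] (L : HeckeModule k) (Q : ℕ) (χ : ℕ → k) : Prop :=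
  ∃ v : L.V, v ≠ 0 ∧ ∀ ℓ : ℕ, ℓ.Prime → ¬ ℓ ∣ Q → L.T ℓ v = χ ℓ • v

/-- INTERFACE (posited object; memo §1). The mod-`p` cohomological realisation of the newform `f = f_W` at full level `p`:
intended CONSTRUCTION — `k ⊇ 𝔽_p` a coefficient field; `H = H¹(𝒴; k)`, `𝒴 = Sh_{K(p)K₀(M)}` (components `X(Γ(p)∩Γ₀(M))`), with its
right `G = GL₂(𝔽_p)`-action `ρ` and the Hecke operators `T_ℓ` (`ℓ ∤ pM`, commuting with `G`); `Hint = H¹_!(𝒴;k)` the interior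
(= image of the compactly supported = of the compact curve's) cohomology; `Λbar` = the image of `Λ/pΛ`, `Λ := H¹(𝒴^{cpt}; ℤ_p)[𝔭_f]`
(saturated `𝔭_f`-eigen-lattice, `𝔭_f = ker(λ_f : 𝕋 → ℤ_p)`), so that `T_ℓ` acts on `Λbar` by `a_ℓ(W) mod p`; `c` = the reduction of
the pull-back `π^* c_s` to `𝒴` of a coordinate class `c_s = s ∘ Φ_f ∈ H¹(X₀(p²M); ℤ)` (`s` a basis functional of `Hom(Λ_f, ℤ)`),
which is primitive (so `c ≠ 0`) and fixed by the split torus `T(𝔽_p)` (`X₀(p²M) = Sh_{I_T K₀(M)}`); `u = (1 1; 0 1)`; `S a b` =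
`σ_{a,b} := Sym^a(k²) ⊗ det^b`; `L a b := H¹(Γ₀(M), σ_{a,b})` with the Ash–Stevens Hecke operators; `shape χ` = the tame inertia
exponents at `p` of the semisimple mod-`p` Galois representation attached (Eichler–Shimura–Deligne, Čebotarev + Brauer–Nesbitt) to a
level-prime-to-`p` eigensystem `χ`: `some s(e₁,e₂)` if `(ρ̄_χ|_{I_p})^{ss} = ω^{e₁} ⊕ ω^{e₂}`, `none` if it is irreducible of niveau 2
(junk elsewhere). The `Prop` fields are the properties that hold BY CONSTRUCTION; the five named predicates below
(`LocalModelCaseA`, `InertiaExponent`, `WeightsOfLevelM`, `HSFiveTermNatural`, `Interiority`) and the dictionary are the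
separately groundable FACTS about this object (desk memo §§2–5b). Existence is NOT smuggled in: it is the closed statement
`HorocyclicCohomologicalInputs` (= construction ∧ facts), the line's stub. -/
structure HoroData (W : WeierstrassCurve ℚ) (p : ℕ) : Type 1 where
  /-- coefficient field `k ⊇ 𝔽_p` -/
  k : Type
  [instField : Field k]
  [instCharP : CharP k p]
  /-- `H = H¹(𝒴; k)` with its `GL₂(𝔽_p)`-action -/
  H : GModule k p
  /-- Hecke operators `T_ℓ` on `H` (`ℓ` prime, `ℓ ∤ pM`) -/
  T : ℕ → H.V →ₗ[k] H.V
  /-- `T_ℓ` commutes with `G` (the Hecke correspondences are `G`-equivariant; memo §1, joint j1) -/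
  T_comm : ∀ (ℓ : ℕ) (g : GL2 p), T ℓ ∘ₗ H.ρ g = H.ρ g ∘ₗ T ℓ
  /-- interior cohomology `H¹_!(𝒴; k) ⊂ H` -/
  Hint : Submodule k H.V
  /-- `H¹_!` is `G`-stable -/
  Hint_G : ∀ (g : GL2 p), ∀ x ∈ Hint, H.ρ g x ∈ Hint
  /-- `Λ̄ = (H¹(𝒴^{cpt};ℤ_p)[𝔭_f]) ⊗ 𝔽_p ↪ H` -/
  Λbar : Submodule k H.V
  /-- `Λ̄` is `G`-stable -/
  Λbar_G : ∀ (g : GL2 p), ∀ x ∈ Λbar, H.ρ g x ∈ Λbar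
  /-- `Λ̄ ⊂ H[𝔪]`: `T_ℓ` acts on `Λ̄` by `a_ℓ(W) mod p` (`ℓ` prime, `ℓ ∤ pN`; `a_ℓ(W)` = Mathlib's `W.LFunction ℓ`) -/
  Λbar_eigen : ∀ ℓ : ℕ, ℓ.Prime → ¬ ℓ ∣ p * W.conductorNorm ℤ →
    ∀ x ∈ Λbar, T ℓ x = ((W.LFunction ℓ : ℤ) : k) • x
  /-- `c̄` = reduction of the primitive `T(𝔽_p)`-fixed coordinate class `π^* c_s` -/
  c : H.V
  c_mem : c ∈ Λbar
  c_ne : c ≠ 0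
  /-- `c` is fixed by the diagonal torus `T(𝔽_p) ⊂ GL₂(𝔽_p)` -/
  c_torus : ∀ g : GL2 p, g.val 0 1 = 0 → g.val 1 0 = 0 → H.ρ g c = c
  /-- the unipotent generator `u` (`z ↦ z + 1/p` on `X_H(p²M)`, `= (1 1; 0 1)` in the `Γ(p)`-picture) -/
  u : GL2 p
  u_val : u.val = !![1, 1; 0, 1]
  /-- `σ_{a,b} = Sym^a(k²) ⊗ det^b` (`0 ≤ a ≤ p−1`, `b mod p−1`) -/
  S : ℕ → ℕ → GModule k p
  /-- `L_{a,b} = H¹(Γ₀(M), σ_{a,b})` with its Hecke operators (Ash–Stevens) -/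
  L : ℕ → ℕ → HeckeModule k
  /-- tame inertia exponents at `p` of the mod-`p` Galois representation attached to an eigensystem -/
  shape : (ℕ → k) → Option (Sym2 (ZMod (p - 1)))

attribute [instance] HoroData.instField HoroData.instCharP

namespace HoroData

variable {W : WeierstrassCurve ℚ} {p : ℕ}

/-- the mod-`p` eigensystem of `f_W`: `ℓ ↦ a_ℓ(W) mod p` -/
def abar (R : HoroData W p) : ℕ → R.k := fun ℓ => ((W.LFunction ℓ : ℤ) : R.k)

/-- `ρ(u) − 1 ∈ End(H)`; the `u`-DEPTH of `x` is the least `d` with `(ρ(u) − 1)^d x = 0` -/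
def uNil (R : HoroData W p) : Module.End R.k R.H.V := R.H.ρ R.u - 1

/-- `G`-equivariance of a `k`-linear map `σ_{a,b} → H` -/
def IsEquivariant (R : HoroData W p) {a b : ℕ} (φ : (R.S a b).V →ₗ[R.k] R.H.V) : Prop :=
  ∀ g : GL2 p, φ ∘ₗ (R.S a b).ρ g = R.H.ρ g ∘ₗ φ

theorem uNil_pow_apply_eq_zero_of_le (R : HoroData W p) {m n : ℕ} (hmn : m ≤ n)
    (h : (R.uNil ^ m) R.c = 0) : (R.uNil ^ n) R.c = 0 := by
  obtain ⟨d, rfl⟩ := Nat.exists_eq_add_of_le hmn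
  rw [add_comm, pow_add, Module.End.mul_apply, h, map_zero]

end HoroData

section Inputs

variable {W : WeierstrassCurve ℚ} [W.IsGloballyMinimal] {p : ℕ}

/-- INPUT 1 — `LocalModelCaseA` (desk memo §2–§3 + the critic's no-`T`-fixed-line remark, V#69 (4)). In the principal-series
`K(p)`-type `σ(τ) = Ind(ω̃^{κ}⊗ω̃^{−κ})` (`Λ ⊗ ℚ̄_p ≅ ρ_f ⊗ σ(τ)`, joint j5) the cyclic lattice `L = ℤ_p[G]·c` of the primitive
`T`-fixed coordinate class is `≃ L_{κ₀}`, with uniserial reduction (socle `σ_good = Sym^{p−1−2κ₀}⊗det^{κ₀}`, cosocle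
`σ_bad = Sym^{2κ₀}⊗det^{−κ₀}`) generated by `c̄` of `u`-depth EXACTLY `p − κ₀` (finite differences of `x ↦ x^{p−1−κ₀}` on `𝔽_p`);
and `Λ_v := Λ ∩ (v ⊗ σ(τ)) ⊇ L` is saturated in `Λ`. DICHOTOMY: EITHER `Λ_v = L` (case A: `depth(c̄) = p − κ₀`) OR `Λ_v ⊋ L`, and
then (Nakayama: `L̄ → Λ̄_v` is not injective, `L̄` uniserial) the image of `L̄` in `Λ̄_v ⊂ Λ̄` is a `G`-equivariant copy of
`σ_bad` CONTAINING `c̄`, of `u`-depth `κ₀ + 1` (case B) — whatever the lattice graph (no two-lattice count needed). Typed over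
the interface with `σ_bad = S (2κ₀) (p−1−κ₀)` (`det^{p−1−κ₀} = det^{−κ₀}`). -/
def LocalModelCaseA (R : HoroData W p) : Prop :=
  ((R.uNil ^ (p - kappa0 W p - 1)) R.c ≠ 0 ∧ (R.uNil ^ (p - kappa0 W p)) R.c = 0) ∨
  ∃ φ : (R.S (2 * kappa0 W p) (p - 1 - kappa0 W p)).V →ₗ[R.k] R.H.V,
    R.IsEquivariant φ ∧ Function.Injective φ ∧ LinearMap.range φ ≤ R.Λbar ∧ R.c ∈ LinearMap.range φ ∧
    (R.uNil ^ (kappa0 W p + 1)) R.c = 0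

/-- INPUT 2 — `InertiaExponent` (desk memo §4, (L1)): `(W[p]|_{I_p})^{ss} = ω^{1−κ} ⊕ ω^{κ}`, `κ = v_p(Δ_min)(p−1)/12` — descent
to good ORDINARY reduction over `ℚ_p^{nr}(p^{1/e})`, `[u]^*ω = u^{−1}ω`, Serre's `ω̃_e = ω^{(p−1)/e}`; i.e. the `shape` of the
eigensystem `ā = (a_ℓ(W) mod p)_ℓ` is `{1−κ, κ}`. (Sign pinned independently by the 18/18 twist pairs of the instrument; a
formal proof must not use the fit — joint j6.) [Serre 1972 §1.7; corpus: paper:doi-10-1090-pcms-009-04 p.59 Ex.16] -/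
def InertiaExponent (R : HoroData W p) : Prop :=
  R.shape R.abar = some s((1 : ZMod (p - 1)) - (kappa W p : ZMod (p - 1)), (kappa W p : ZMod (p - 1)))

/-- INPUT 3 — `WeightsOfLevelM` (Lemma W's input as ONE statement; desk memo §5 «standard recipe»): every mod-`p` eigensystem
occurring in `H¹(Γ₀(M), Sym^a ⊗ det^b)`, `a + 2 ≤ p − 1`, is `ℓ ↦ ℓ^b·a_ℓ(g)` for a mod-`p` form `g` of weight `a+2` and level
`Γ₀(M)` (Ash–Stevens 1986, cusp forms AND Eisenstein series, `p ∤ M`, `p ≥ 5`), hence its inertia shape is `ω^{b} ⊕ ω^{a+1+b}`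
(`g` ordinary: Deligne; `g` Eisenstein: directly) or irreducible of niveau 2 (`g` non-ordinary, `2 ≤ a+2 ≤ p`: Fontaine).
[Ash–Stevens doi:10.1215/s0012-7094-86-05346-9 §§2–3; corpus: paper:doi-10-1090-pcms-009-04 pp.24–25] -/
def WeightsOfLevelM (R : HoroData W p) : Prop :=
  ∀ (a b : ℕ) (χ : ℕ → R.k), a + 3 ≤ p →
    (R.L a b).OccursIn (p * W.conductorNorm ℤ) χ →
    R.shape χ = none ∨
      R.shape χ = some s((b : ZMod (p - 1)), (a : ZMod (p - 1)) + 1 + (b : ZMod (p - 1)))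

/-- INPUT 4 — `HSFiveTermNatural` (Lemma HS + Lemma B of the desk memo, §5–§5b, with the eigen-bookkeeping): let
`φ : σ_{a,b} → H = H¹(𝒴;k)` be `G`-equivariant, non-zero, Hecke-EIGEN with system `χ`, with values in the INTERIOR cohomology.
Five-term sequence of Hochschild–Serre for `Γ′ = Γ(p)∩Γ₀(M) ⊲ Γ₀(M)` (Frobenius reciprocity `H¹(𝒴) = Ind_{G¹}^{G} H¹(Γ′)`):
`H¹(Γ₀(M), σ^∨) →res→ Hom_G(σ, H¹(𝒴)) →d₂→ H²(G¹, σ^∨)`, exact, Hecke-equivariant (Ash–Stevens §1; joint j1); Lemma B: `d₂φ` is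
detected by restriction to `P̄ = ±U(𝔽_p) ⊇ Syl_p(G¹)` (naturality under `Stab(∞) ⇝ Γ₀(M)`), where it equals `d₂` of the BOUNDARY
restriction of `φ`, which is `0` for interior `φ` — so `φ = res(ψ)`; decomposing the finite-dimensional `H¹(Γ₀(M), σ^∨)` into
generalised Hecke eigenspaces, `φ = res(ψ_χ)` with `ψ_χ ≠ 0` in the `χ`-part, so `χ` OCCURS in `H¹(Γ₀(M), σ_{a,b}^∨) =
H¹(Γ₀(M), σ_{a,b′})`, `a + b + b′ ≡ 0 (mod p−1)` (`(Sym^a)^∨ ≅ Sym^a ⊗ det^{−a}` for `a ≤ p−1`). Elementary check on the residue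
(`σ = Ad`): the tautological class `γ ↦ (γ−1)/p` has `r(u^p) = E₁₂ ≠ 0` (not interior) while `res(ψ)(u^p) = (u−1)^{p−1}ψ(u) = 0`. -/
def HSFiveTermNatural (R : HoroData W p) : Prop :=
  ∀ (a b b' : ℕ) (χ : ℕ → R.k) (φ : (R.S a b).V →ₗ[R.k] R.H.V),
    a ≤ p - 1 → p - 1 ∣ a + b + b' →
    R.IsEquivariant φ → φ ≠ 0 → LinearMap.range φ ≤ R.Hint →
    (∀ ℓ : ℕ, ℓ.Prime → ¬ ℓ ∣ p * W.conductorNorm ℤ → R.T ℓ ∘ₗ φ = χ ℓ • φ) →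
    (R.L a b').OccursIn (p * W.conductorNorm ℤ) χ

/-- INPUT 5 — `Interiority` (desk memo §5b, joint j2): `Λ̄ ⊂ H¹_!(𝒴; 𝔽_p)` — `Λ` is cut out of the cohomology of the COMPACT
curve (`H¹(X′, Y′; 𝔽_p) = 0`, `im(H¹(X′) ↪ H¹(Y′)) = ker(H¹(Y′) → ⊕_{cusps} H¹(Γ′_c))`); equivalently, for the open-curve
lattice, `H¹(∂𝒴; ℤ_p)` is torsion-free with Eisenstein eigenvalues `α(ℓ) + ℓβ(ℓ) ≠ a_ℓ(f)` (Hasse). -/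
def Interiority (R : HoroData W p) : Prop :=
  R.Λbar ≤ R.Hint

/-- DICTIONARY (support; desk memo §1, joint j7; Shimura Prop. 3.64 + `diag(p,1) Γ_H(p²M) diag(p,1)⁻¹ = ±Γ′`, `u ↦ (1 1;0 1)`):
the classes `{∞, γ∞}`, `γ = (A B; C D) ∈ Γ_H(N)` (`N ∣ C`, `A ≡ D ≡ ±1 (mod p)`), generate `H₁(X_H(p²M); ℤ)`, `u^j{∞,γ∞} = {∞, γ∞ + j/p}`,
and `⟨(u* − 1)^k π^*c_s, {∞,γ∞}⟩ = ± s(Δ^k_{1/p}{∞, γ∞}_f)`; so `(ρ(u) − 1)^{(p−1)/2} c̄ ≠ 0` yields an admissible cusp `A/C`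
(`C > 0` after `γ ↦ −γ`, `gcd(A,C) = 1` from `AD − BC = 1`) whose horocyclic `(p−1)/2`-th difference is NOT in `p·Λ_f`. -/
def HorocyclicDictionary [W.IsElliptic] [NeZero (W.conductorNorm ℤ)]
    (D : ModularParametrizationData W (W.conductorNorm ℤ)) (R : HoroData W p) : Prop :=
  (R.uNil ^ ((p - 1) / 2)) R.c ≠ 0 →
    ∃ (A C : ℤ), (W.conductorNorm ℤ : ℤ) ∣ C ∧ 0 < C ∧ IsCoprime A C ∧ (p : ℤ) ∣ A * A - 1 ∧
      ¬ ∃ y ∈ periodLattice D.f, horocyclicDifference D.f p A C = (p : ℂ) * y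

/-- THE KERNEL-CHECKED SKELETON OF THEOREM R⁺ (desk memo §5b), one curve at a time, over the interface: the five inputs force
case A, hence `u`-depth `p − κ₀ ≥ (p−1)/2 + 1`, i.e. `(ρ(u)−1)^{(p−1)/2} c̄ ≠ 0` (TOP). Proof = the memo's: in case B the copy of
`σ_bad ∋ c̄` inside `Λ̄` is a non-zero `G`-equivariant Hecke-eigen (system `ā`, by `Λ̄ ⊂ H[𝔪]`) map into `H¹_!` (Interiority), so by
HS+B the system `ā` occurs in `H¹(Γ₀(M), σ_bad^∨ = σ_{2κ₀, −κ₀})`, whose shapes are `{−κ₀, κ₀+1}` or niveau 2 (Weights), while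
`ā` has shape `{1−κ, κ}` (InertiaExponent): the purely combinatorial clash `hclash` (Lemma W: `{−κ₀,κ₀+1} ≠ {1−κ₀,κ₀} mod p−1`
for `1 ≤ κ₀ ≤ (p−3)/2`, discharged row by row in `horocyclic57_of_inputs`). -/
theorem uDeep_of_inputs (R : HoroData W p)
    (hk : (p - 1) / 2 ≤ p - kappa0 W p - 1) (ha : 2 * kappa0 W p + 3 ≤ p)
    (hclash : ¬ (R.shape R.abar = none ∨
      R.shape R.abar = some s(((p - 1 - kappa0 W p : ℕ) : ZMod (p - 1)),
        ((2 * kappa0 W p : ℕ) : ZMod (p - 1)) + 1 + ((p - 1 - kappa0 W p : ℕ) : ZMod (p - 1)))))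
    (hA : LocalModelCaseA R) (hW : WeightsOfLevelM R) (hHS : HSFiveTermNatural R) (hInt : Interiority R) :
    (R.uNil ^ ((p - 1) / 2)) R.c ≠ 0 := by
  rcases hA with ⟨hAne, -⟩ | ⟨φ, hφG, hφinj, hφΛ, hcφ, -⟩
  · exact fun h0 => hAne (R.uNil_pow_apply_eq_zero_of_le hk h0)
  · exfalso
    have hφne : φ ≠ 0 := by
      intro h0
      obtain ⟨y, hy⟩ := LinearMap.mem_range.1 hcφ
      rw [h0, LinearMap.zero_apply] at hy
      exact R.c_ne hy.symm
    have hφeig : ∀ ℓ : ℕ, ℓ.Prime → ¬ ℓ ∣ p * W.conductorNorm ℤ → R.T ℓ ∘ₗ φ = R.abar ℓ • φ := by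
      intro ℓ hℓ hℓN
      ext x
      simp only [LinearMap.comp_apply, LinearMap.smul_apply]
      exact R.Λbar_eigen ℓ hℓ hℓN (φ x) (hφΛ (LinearMap.mem_range_self φ x))
    have hocc := hHS (2 * kappa0 W p) (p - 1 - kappa0 W p) (p - 1 - kappa0 W p) R.abar φ
      (by omega) ⟨2, by omega⟩ hφG hφne (hφΛ.trans hInt) hφeig
    exact hclash (hW (2 * kappa0 W p) (p - 1 - kappa0 W p) R.abar (by omega) hocc)

/-- Row arithmetic for the three H57 rows: `(p; v) ∈ {(5;3), (7;2), (7;4)}` gives `(κ, κ₀) = (1,1), (1,1), (2,2)`; the numeric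
side conditions of `uDeep_of_inputs`, and LEMMA W's exponent-set clash `{1−κ, κ} ≠ {−κ₀, κ₀+1}` in `ZMod (p−1)` (kernel-decided). -/
theorem rows57_arith
    (hrow : (p = 5 ∧ padicValInt 5 W.minimalDiscriminantInt = 3) ∨
      (p = 7 ∧ padicValInt 7 W.minimalDiscriminantInt ∈ ({2, 4} : Finset ℕ))) :
    (p - 1) / 2 ≤ p - kappa0 W p - 1 ∧ 2 * kappa0 W p + 3 ≤ p ∧
    (some s((1 : ZMod (p - 1)) - (kappa W p : ZMod (p - 1)), (kappa W p : ZMod (p - 1))) : Option (Sym2 (ZMod (p - 1))))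
        ≠ none ∧
    (some s((1 : ZMod (p - 1)) - (kappa W p : ZMod (p - 1)), (kappa W p : ZMod (p - 1))) : Option (Sym2 (ZMod (p - 1)))) ≠
      some s(((p - 1 - kappa0 W p : ℕ) : ZMod (p - 1)),
        ((2 * kappa0 W p : ℕ) : ZMod (p - 1)) + 1 + ((p - 1 - kappa0 W p : ℕ) : ZMod (p - 1))) := by
  rcases hrow with ⟨rfl, hv⟩ | ⟨rfl, hv⟩
  · have hκ : kappa W 5 = 1 := by simp [kappa, hv]
    have hκ0 : kappa0 W 5 = 1 := by simp [kappa0, hκ]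
    rw [hκ, hκ0]
    refine ⟨by norm_num, by norm_num, by decide, by decide⟩
  · have hv' : padicValInt 7 W.minimalDiscriminantInt = 2 ∨ padicValInt 7 W.minimalDiscriminantInt = 4 := by
      simpa only [Finset.mem_insert, Finset.mem_singleton] using hv
    rcases hv' with hv | hv
    · have hκ : kappa W 7 = 1 := by simp [kappa, hv]
      have hκ0 : kappa0 W 7 = 1 := by simp [kappa0, hκ]
      rw [hκ, hκ0]
      refine ⟨by norm_num, by norm_num, by decide, by decide⟩
    · have hκ : kappa W 7 = 2 := by simp [kappa, hv]
      have hκ0 : kappa0 W 7 = 2 := by simp [kappa0, hκ]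
      rw [hκ, hκ0]
      refine ⟨by norm_num, by norm_num, by decide, by decide⟩

/-- THE LINE'S NEW STUB STATEMENT (closed; construction ∧ facts): on every row of H57 the newform `f_W` admits a mod-`p`
cohomological realisation datum satisfying the five inputs and the dictionary. For the GENUINE datum (memo §1) each conjunct is
a separately groundable fact: `LocalModelCaseA` (§2–3), `InertiaExponent` (§4), `WeightsOfLevelM` (Ash–Stevens + Deligne/Fontaine
+ Eisenstein), `HSFiveTermNatural` (Lemma HS + Lemma B), `Interiority` (j2), `HorocyclicDictionary` (j7). Binders = the crux's. -/
def HorocyclicCohomologicalInputs : Prop :=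
  ∀ (W : WeierstrassCurve ℚ) [W.IsElliptic] [W.IsGloballyMinimal] (p : ℕ) [Fact p.Prime]
    [NeZero (W.conductorNorm ℤ)] (D : ModularParametrizationData W (W.conductorNorm ℤ))
    (_hsq : p ^ 2 ∣ W.conductorNorm ℤ),
    ((p = 5 ∧ padicValInt 5 W.minimalDiscriminantInt = 3) ∨
      (p = 7 ∧ padicValInt 7 W.minimalDiscriminantInt ∈ ({2, 4} : Finset ℕ))) →
    ¬ W.HasIrreducibleModPGaloisRep p →
    ¬ ((W.quadraticTwist (((-1 : ℤ) ^ (p / 2) * p : ℤ) : ℚ)).HasGoodReductionAt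
          ((Rat.HeightOneSpectrum.primesEquiv (R := ℤ)).symm ⟨p, Fact.out⟩) ∨
       (W.quadraticTwist (((-1 : ℤ) ^ (p / 2) * p : ℤ) : ℚ)).HasMultiplicativeReductionAt
          ((Rat.HeightOneSpectrum.primesEquiv (R := ℤ)).symm ⟨p, Fact.out⟩)) →
    (∀ z ∈ D.L.lattice, ∃ w ∈ periodLattice D.f, z = D.c * w) →
    ((p = 5 → (3 : ℤ) ≤ padicValRat 5 (W.j - 1728)) ∧ (p = 7 → (4 : ℤ) ≤ padicValRat 7 W.j)) →
    ∃ R : HoroData W p, LocalModelCaseA R ∧ InertiaExponent R ∧ WeightsOfLevelM R ∧ HSFiveTermNatural R ∧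
      Interiority R ∧ HorocyclicDictionary D R

/-- KERNEL-CHECKED GLUE `horocyclic57_of_inputs`: the five inputs (+ dictionary) ⟹ H57 `OrdinaryCornerDeepUnstarredHorocyclic`. -/
theorem horocyclic57_of_inputs (h : HorocyclicCohomologicalInputs) : OrdinaryCornerDeepUnstarredHorocyclic := by
  intro W _ _ p _ _ D hsq hrow hred hadd hopt hdeep
  obtain ⟨R, hA, hI, hW, hHS, hInt, hDict⟩ := h W p D hsq hrow hred hadd hopt hdeep
  obtain ⟨hk, ha, hnone, hne⟩ := rows57_arith (W := W) hrow
  have hI' : R.shape R.abar =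
      some s((1 : ZMod (p - 1)) - (kappa W p : ZMod (p - 1)), (kappa W p : ZMod (p - 1))) := hI
  refine hDict (uDeep_of_inputs R hk ha ?_ hA hW hHS hInt)
  rw [hI']
  rintro (h0 | h1)
  · exact hnone h0
  · exact hne h1

end Inputs

/-- STUB H57-INPUTS (v3; takes the place of v1–v2's `stub_horocyclic57`) — the genuine mod-`p` cohomological realisation datum of `f_W`
(memo §1; definition request D-H1) EXISTS on every H57 row and satisfies `LocalModelCaseA` (§2–3), `InertiaExponent` (§4),
`WeightsOfLevelM` (Ash–Stevens + Deligne/Fontaine + Eisenstein), `HSFiveTermNatural` (Lemma HS + Lemma B, §5–5b), `Interiority` (j2) and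
`HorocyclicDictionary` (j7). Size: construction L (singular cohomology of a modular curve as a `GL₂(𝔽_p)`×Hecke module + comparison with
`periodLattice`) + six M/L lemmas, each print-level EXCEPT Lemma B (desk-proved, memo §5b; critic V#69 P5 asks an independent read). As a
closed `Prop` it is not weaker than H57 (junk case-A data); its content is the six predicates for the GENUINE datum. Why it might fail:
Lemma B's naturality square at the `p`-Sylow (`±U(𝔽_p) ⊂ Stab(∞)`) for `M` with torsion in `Γ₀(M)`; the interior-vs-open bookkeeping
(`Λ` from the compact curve); a sign slip in `InertiaExponent` (j6 — pinned by 18/18 but a proof may not use the fit).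
[cite: EdixhovenManin1991, §4] [cite: MazurTateTeitelbaum1986Invent, §I.8] [cite: Shimura1971, Prop. 3.64] -/
theorem stub_horocyclicInputs57 : HorocyclicCohomologicalInputs := by
  sorry

/-- THEOREM H57 (v3; in v1–v2 the stub `stub_horocyclic57`): the unstarred deep optimal form is `u`-deep
(`OrdinaryCornerDeepUnstarredHorocyclic`), from the six typed inputs by the kernel-checked Theorem R⁺ glue `horocyclic57_of_inputs`.
(The v2 split `horocyclic57_of_offResidue_of_residualAvoidance` remains available as an alternative decomposition.) -/
theorem horocyclic57 : OrdinaryCornerDeepUnstarredHorocyclic :=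
  horocyclic57_of_inputs stub_horocyclicInputs57

/-- STUB H57→K18b″ — **CLOSED** (v3): PROVED by width seat bsd-line-ml23-c5-p1-w3 g3 as
`Theorems.ordinaryCornerDeepUnstarredNotBottom_of_horocyclicWitnesses` (p637599; H57 spelled out verbatim there, since this Cruxes file is not
importable), with the exact dictionaries K18b″ ⟺ H57′ (`…NotBottomIffHorocyclic.lean`, p638420) and C1(13) ⟺ witnesses (`…COneIffHorocyclic.lean`,
p638660). Kept under its stub name for the record; no longer a stub (no `sorry`). v1–v2 proof plan (now the landed proof): `γ_j := u_j γ u_j⁻¹ ∈ Γ₀(N)`,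
`h(n) := {∞, A/C + n/p}_f ∈ Λ_f` `p`-periodic, BOTTOM + `modularSymbol_charTwist` give `Σ_u χ(u) h(j+u) ∈ pΛ_f`, and in `𝔽_p[ℤ/p]`
`Σ χ(u) s^u = c·(s−1)^k·unit`, `c ≠ 0`, so every `Δ^k_{1/p}{∞, γ∞}_f ∈ pΛ_f`. [cite: Shimura1971, Prop. 3.64] [cite: MazurTateTeitelbaum1986Invent, §I.8] -/
theorem stub_notBottom_of_horocyclic57 :
    OrdinaryCornerDeepUnstarredHorocyclic →
    Summit.BirchSwinnertonDyer.BirchSwinnertonDyer.Theses.TwistFamilyManinDescent.OrdinaryCornerDeepUnstarredNotBottom :=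
  fun h => ordinaryCornerDeepUnstarredNotBottom_of_horocyclicWitnesses h

/-- STUB 18R-INPUTS — **two items of route `TwistFamilyManinDescent` BY NAME** (planner bsd-idea-3, LINE 18R, 2026-08-28):
I9 `OrdinaryCornerOptimalSerreTateDeep` (stmt-27660; instrument-born orientation law «optimal ⇒ Serre–Tate-deep», 1064/1064 classes) and
K18a″ `OrdinaryCornerDeepEdixhovenDichotomy` (stmt-27661; Edixhoven's dichotomy `p ∣ c ⇒ unstarred ∧ BOTTOM` continued to `e = p − 1`
for deep curves). OPEN; owned there; not targets of this line. (v3: the v1–v2 third conjunct `OrdinaryCornerOffTable`, stmt-27663, is the lead's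
THEOREM `Theorems.ordinaryCornerOffTable_proof`, p636035, and is fed to the glue by name.) [cite: EdixhovenManin1991, Props. 7–9 and §4]
[cite: Katz1981SerreTate, Thm. 2.1] -/
theorem stub_deepInputs18R :
    Summit.BirchSwinnertonDyer.BirchSwinnertonDyer.Theses.TwistFamilyManinDescent.OrdinaryCornerOptimalSerreTateDeep ∧
    Summit.BirchSwinnertonDyer.BirchSwinnertonDyer.Theses.TwistFamilyManinDescent.OrdinaryCornerDeepEdixhovenDichotomy := by
  sorry

/-- THEOREM (stmt-27552 `OrdinaryCornerManinResidual`, the record's `ord57_of_leaves`): from I9, K18a″ (`stub_deepInputs18R`), THIS LINE's K18b″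
(`stub_notBottom_of_horocyclic57 horocyclic57`) and the lead's `ordinaryCornerOffTable_proof` (stmt-27663, p636035), through pub/bsd-wall's LANDED 18R glue
`TwistFamilyManinDescent.ordinaryCornerOfSerreTateDepth_proof` (stmt-27664; v3 carried a local copy of its proof, dropped in v4). -/
theorem ord57_of_horocyclic :
    Summit.BirchSwinnertonDyer.BirchSwinnertonDyer.Theses.TwistFamilyManinDescent.OrdinaryCornerManinResidual :=
  TwistFamilyManinDescent.ordinaryCornerOfSerreTateDepth_proof stub_deepInputs18R.1 stub_deepInputs18R.2
    (stub_notBottom_of_horocyclic57 horocyclic57) ordinaryCornerOffTable_proof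

/-! ## v4: the SAME six inputs decide the second NOT-BOTTOM leaf, C1 (`p ≥ 11`), with a GENERIC Lemma W

The width seat's dictionary `Theorems.eisensteinOrdinaryTwistLatticeNotBottom_iff_horocyclicWitnesses` (p638660) makes route
`TwistFamilyManinDescent`'s leaf C1 `EisensteinOrdinaryTwistLatticeNotBottom` (stmt-25939: `p ≥ 11`, additive, `W[p]` reducible, (G)-ordinary,
UNSTARRED `v_p Δ_min ≤ 4`, `X₀`-optimal ⟹ `g(χ)Λ(f⊗χ) ⊄ pΛ(f)`) EQUIVALENT to the existence of horocyclic witnesses on those rows. On them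
`v ∈ {2,3,4}`, `e = 12/gcd(12,v) ∈ {6,4,3}` divides `p − 1 = e·m`, and `κ = κ₀ = m`; the side conditions of `uDeep_of_inputs` and LEMMA W's clash
`{1−m, m} ≠ {−m, m+1} (mod e·m)` hold for EVERY such `p` (proved below once and for all: `1 ≢ 0` and `2m ≢ 0 (mod em)` as `e ≥ 3`) — and since
`κ₀ = m ≥ 2` at `p ≥ 13` (no rows at `p = 11`), Lemma C gives `H²(SL₂(𝔽_p), σ_bad^∨) = 0`: the transgression obstruction of the residue case
(`κ₀ = 1`, Lemma B) does NOT even arise on the C1 rows. -/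

section InputsCOne

variable {W : WeierstrassCurve ℚ} [W.IsGloballyMinimal] {p : ℕ}

/-- LEMMA W, generic form: in `ZMod (e·m)`, `e ≥ 3`, `m ≥ 1`, the unordered pairs `{1 − m, m}` and `{(em − m), 2m + 1 + (em − m)} = {−m, m+1}`
differ (`1 − m = −m` forces `1 = 0`; `m = −m` forces `em ∣ 2m`, i.e. `e ∣ 2`). -/
theorem sym2_clash {n m e : ℕ} (hn : n = e * m) (he : 3 ≤ e) (hm : 0 < m) :
    (some s((1 : ZMod n) - (m : ZMod n), (m : ZMod n)) : Option (Sym2 (ZMod n))) ≠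
      some s(((n - m : ℕ) : ZMod n), ((2 * m : ℕ) : ZMod n) + 1 + ((n - m : ℕ) : ZMod n)) := by
  have hmn : m ≤ n := by rw [hn]; nlinarith
  have h1n : 1 < n := by rw [hn]; nlinarith
  haveI : Fact (1 < n) := ⟨h1n⟩
  haveI : NeZero n := ⟨by omega⟩
  have hcast : ((n - m : ℕ) : ZMod n) = -(m : ZMod n) := by
    rw [Nat.cast_sub hmn, ZMod.natCast_self, zero_sub]
  rw [hcast]
  intro h
  have h' := Option.some.inj h
  rw [Sym2.eq_iff] at h'
  rcases h' with ⟨h1, -⟩ | ⟨-, h2⟩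
  · have h10 : (1 : ZMod n) = 0 := by linear_combination h1
    exact one_ne_zero h10
  · have h0 : ((2 * m : ℕ) : ZMod n) = 0 := by push_cast; linear_combination h2
    rw [ZMod.natCast_eq_zero_iff, hn] at h0
    have he2 : e ∣ 2 := Nat.dvd_of_mul_dvd_mul_right hm h0
    have := Nat.le_of_dvd (by norm_num) he2
    omega

/-- Row arithmetic for the C1 rows: `p ≥ 11`, `v = v_p(Δ_min) ∈ {2,3,4}`, `e = 12/gcd(12,v) ∣ p − 1`. Then `κ = κ₀ = (p−1)/e`, and the
numeric side conditions of `uDeep_of_inputs` and LEMMA W's clash hold (generic `p`; `sym2_clash`). -/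
theorem rowsCOne_arith (hp : 11 ≤ p)
    (hv : padicValInt p W.minimalDiscriminantInt = 2 ∨ padicValInt p W.minimalDiscriminantInt = 3 ∨
      padicValInt p W.minimalDiscriminantInt = 4)
    (he : 12 / Nat.gcd 12 (padicValInt p W.minimalDiscriminantInt) ∣ p - 1) :
    (p - 1) / 2 ≤ p - kappa0 W p - 1 ∧ 2 * kappa0 W p + 3 ≤ p ∧
    (some s((1 : ZMod (p - 1)) - (kappa W p : ZMod (p - 1)), (kappa W p : ZMod (p - 1))) : Option (Sym2 (ZMod (p - 1))))
        ≠ none ∧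
    (some s((1 : ZMod (p - 1)) - (kappa W p : ZMod (p - 1)), (kappa W p : ZMod (p - 1))) : Option (Sym2 (ZMod (p - 1)))) ≠
      some s(((p - 1 - kappa0 W p : ℕ) : ZMod (p - 1)),
        ((2 * kappa0 W p : ℕ) : ZMod (p - 1)) + 1 + ((p - 1 - kappa0 W p : ℕ) : ZMod (p - 1))) := by
  rcases hv with hv | hv | hv
  · have he6 : 6 ∣ p - 1 := by simpa [hv] using he
    obtain ⟨m, hm⟩ := he6
    have hκ : kappa W p = m := by rw [kappa, hv]; omega
    have hκ0 : kappa0 W p = m := by rw [kappa0, hκ]; omega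
    rw [hκ, hκ0]
    exact ⟨by omega, by omega, Option.some_ne_none _, sym2_clash hm (by norm_num) (by omega)⟩
  · have he4 : 4 ∣ p - 1 := by simpa [hv] using he
    obtain ⟨m, hm⟩ := he4
    have hκ : kappa W p = m := by rw [kappa, hv]; omega
    have hκ0 : kappa0 W p = m := by rw [kappa0, hκ]; omega
    rw [hκ, hκ0]
    exact ⟨by omega, by omega, Option.some_ne_none _, sym2_clash hm (by norm_num) (by omega)⟩
  · have he3 : 3 ∣ p - 1 := by simpa [hv] using he
    obtain ⟨m, hm⟩ := he3
    have hκ : kappa W p = m := by rw [kappa, hv]; omega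
    have hκ0 : kappa0 W p = m := by rw [kappa0, hκ]; omega
    rw [hκ, hκ0]
    exact ⟨by omega, by omega, Option.some_ne_none _, sym2_clash hm (by norm_num) (by omega)⟩

/-- THE C1-ROW VERSION OF THE STUB STATEMENT (closed; construction ∧ facts): on every row of C1 (`p ≥ 11`, additive, `W[p]` reducible,
(G)-ordinary, unstarred, `X₀`-optimal datum) the newform `f_W` admits a mod-`p` cohomological realisation datum satisfying the SAME six
predicates. Binders = those of the right-hand side of `eisensteinOrdinaryTwistLatticeNotBottom_iff_horocyclicWitnesses`. On these rows `κ₀ ≥ 2`,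
so `HSFiveTermNatural` needs only Lemma HS + Lemma C (`H²(SL₂(𝔽_p), Sym^{2κ₀}⊗det^{−κ₀}) = 0`), not Lemma B. -/
def HorocyclicCohomologicalInputsCOne : Prop :=
  ∀ (W : WeierstrassCurve ℚ) [W.IsElliptic] [W.IsGloballyMinimal] (p : ℕ) [Fact p.Prime]
    [NeZero (W.conductorNorm ℤ)] (D : ModularParametrizationData W (W.conductorNorm ℤ))
    (_hsq : p ^ 2 ∣ W.conductorNorm ℤ), 11 ≤ p → Addv W p → ¬ Irr W p → TypeGOrd W p →
    padicValInt p W.minimalDiscriminantInt ≤ 4 →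
    (∀ z ∈ D.L.lattice, ∃ w ∈ periodLattice D.f, z = D.c * w) →
    ∃ R : HoroData W p, LocalModelCaseA R ∧ InertiaExponent R ∧ WeightsOfLevelM R ∧ HSFiveTermNatural R ∧
      Interiority R ∧ HorocyclicDictionary D R

/-- KERNEL-CHECKED GLUE `horocyclicCOne_of_inputs`: the six inputs ⟹ horocyclic witnesses on every C1 row (the right-hand side of the width
seat's dictionary, with the extra congruence `p ∣ A² − 1` dropped). Row arithmetic: `v ∈ {2,3,4,6,8,9,10}` (Kodaira list at an additive `p ≥ 5`
with `v_p(j) ≥ 0`, `padicValInt_minimalDiscriminantInt_mem_of_addv_of_padicValRat_j_nonneg` + `padicValRat_j_nonneg_of_typeGOrd`) and `v ≤ 4`;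
`e ∣ p − 1` from (G) (`typeG_iff_not_subM_and_semistabilityIndex_dvd`). -/
theorem horocyclicCOne_of_inputs (h : HorocyclicCohomologicalInputsCOne) :
    ∀ (W : WeierstrassCurve ℚ) [W.IsElliptic] [W.IsGloballyMinimal] (p : ℕ) [Fact p.Prime]
      [NeZero (W.conductorNorm ℤ)] (D : ModularParametrizationData W (W.conductorNorm ℤ))
      (_hsq : p ^ 2 ∣ W.conductorNorm ℤ), 11 ≤ p → Addv W p → ¬ Irr W p → TypeGOrd W p →
      padicValInt p W.minimalDiscriminantInt ≤ 4 →
      (∀ z ∈ D.L.lattice, ∃ w ∈ periodLattice D.f, z = D.c * w) →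
      ∃ (A C : ℤ), (W.conductorNorm ℤ : ℤ) ∣ C ∧ 0 < C ∧ IsCoprime A C ∧
        ¬ ∃ y ∈ periodLattice D.f, horocyclicDifference D.f p A C = (p : ℂ) * y := by
  intro W _ _ p _ _ D hsq hp11 hadd hred hord hv4 hopt
  obtain ⟨R, hA, hI, hW, hHS, hInt, hDict⟩ := h W p D hsq hp11 hadd hred hord hv4 hopt
  have hp5 : 5 ≤ p := by omega
  have hj : 0 ≤ padicValRat p W.j := padicValRat_j_nonneg_of_typeGOrd W p hord
  have hmem := padicValInt_minimalDiscriminantInt_mem_of_addv_of_padicValRat_j_nonneg W p hp5 hadd hj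
  have hv : padicValInt p W.minimalDiscriminantInt = 2 ∨ padicValInt p W.minimalDiscriminantInt = 3 ∨
      padicValInt p W.minimalDiscriminantInt = 4 := by omega
  have he : 12 / Nat.gcd 12 (padicValInt p W.minimalDiscriminantInt) ∣ p - 1 :=
    ((typeG_iff_not_subM_and_semistabilityIndex_dvd W p hp5).mp hord.typeG).2
  obtain ⟨hk, ha, hnone, hne⟩ := rowsCOne_arith (W := W) hp11 hv he
  have hI' : R.shape R.abar =
      some s((1 : ZMod (p - 1)) - (kappa W p : ZMod (p - 1)), (kappa W p : ZMod (p - 1))) := hI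
  have hdeep : (R.uNil ^ ((p - 1) / 2)) R.c ≠ 0 := by
    refine uDeep_of_inputs R hk ha ?_ hA hW hHS hInt
    rw [hI']
    rintro (h0 | h1)
    · exact hnone h0
    · exact hne h1
  obtain ⟨A, C, hNC, hC, hAC, -, hnot⟩ := hDict hdeep
  exact ⟨A, C, hNC, hC, hAC, hnot⟩

end InputsCOne

/-- STUB C1-INPUTS (v4) — the genuine mod-`p` cohomological realisation datum of `f_W` (memo §1; D-H1) EXISTS on every C1 row (`p ≥ 11`, additive,
`W[p]` reducible, (G)-ordinary, unstarred, `X₀`-optimal) and satisfies the six predicates. Same construction as `stub_horocyclicInputs57`; the facts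
are EASIER here: `κ₀ = (p−1)/e ≥ 2`, so the five-term step needs no Lemma B (Lemma C: `H²(SL₂(𝔽_p), Sym^{2κ₀}⊗det^{−κ₀}) = 0` for `2κ₀ ≠ 2`),
and `WeightsOfLevelM` is used at `a = 2κ₀ ≤ 2(p−1)/3 ≤ p − 3`. Why it might fail: a sign slip in `InertiaExponent` (j6) — at `p ≥ 11` the
instrument has NOT been run (critic's P2 sweep would extend `horodepth.py` to `p ∈ {13, 17, 19}`); the interior-vs-open bookkeeping (j2).
Closes leaf C1 (stmt-25939) through `cOne_of_horocyclicInputs`. [cite: EdixhovenManin1991, §4] [cite: Shimura1971, Prop. 3.64]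
[cite: MazurTateTeitelbaum1986Invent, §I.8] -/
theorem stub_horocyclicInputsCOne : HorocyclicCohomologicalInputsCOne := by
  sorry

/-- THEOREM C1 (v4): route `TwistFamilyManinDescent`'s leaf `EisensteinOrdinaryTwistLatticeNotBottom` (stmt-25939) from the six typed inputs on the
C1 rows, by `horocyclicCOne_of_inputs` and the width seat's dictionary `eisensteinOrdinaryTwistLatticeNotBottom_iff_horocyclicWitnesses` (p638660). -/
theorem cOne_of_horocyclicInputs (h : HorocyclicCohomologicalInputsCOne) :
    Summit.BirchSwinnertonDyer.BirchSwinnertonDyer.Theses.TwistFamilyManinDescent.EisensteinOrdinaryTwistLatticeNotBottom :=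
  eisensteinOrdinaryTwistLatticeNotBottom_iff_horocyclicWitnesses.mpr
    (fun W _ _ p _ _ D hsq hp11 hadd hred hord hv4 hopt =>
      horocyclicCOne_of_inputs h W p D hsq hp11 hadd hred hord hv4 hopt)

/-- THEOREM C1 of the line (v4). -/
theorem notBottom13 :
    Summit.BirchSwinnertonDyer.BirchSwinnertonDyer.Theses.TwistFamilyManinDescent.EisensteinOrdinaryTwistLatticeNotBottom :=
  cOne_of_horocyclicInputs stub_horocyclicInputsCOne

/-- STUB SS57 (v10–v13) — **crux K15b BY NAME** (`TwistFamilyManinDescent.SupersingularUnstarredStrongManinUnit`,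
stmt-BirchSwinnertonDyer-27071, route `TwistFamilyManinDescent`, planner bsd-idea-3): `p ∤ c` for the lattice-optimal curve on the
potentially SUPERSINGULAR Raynaud rows `(5; IV)` (`ord₅ Δ_min = 4`, `e = 3 < 4`) and `(7; III)` (`ord₇ Δ_min = 3`, `e = 4 < 6`),
`p² ∣ N`, `W[p]` reducible, `W ⊗ p*` still additive at `p`. OPEN; owned there. Printed MECHANISM (lead gen 6 reading of the
typescript): Edixhoven's Prop. 7 at `e < p − 1` + the parity lemma read directly on `φ` + Prop. 8 — NOT the §4 twist dichotomy
(these rows FLIP in range, 771 + 122 orbits). Census `N ≤ 5·10⁵`: all `c = 1`.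
[cite: EdixhovenManin1991, Props. 7–8 and §4] [cite: Raynaud1974, Cor. 3.3.6] -/
theorem stub_ss57 :
    Summit.BirchSwinnertonDyer.BirchSwinnertonDyer.Theses.TwistFamilyManinDescent.SupersingularUnstarredStrongManinUnit := by
  sorry

/-- STUB K15a (v13) — **the orientation item BY NAME** (`TwistFamilyManinDescent.SupersingularStrongIsUnstarred`,
stmt-BirchSwinnertonDyer-27072, route `TwistFamilyManinDescent`: on the potentially SUPERSINGULAR `W[p]`-reducible rows at
`p ∈ {5, 7}` the `X₀`-optimal curve is UNSTARRED — «SS-Stevens at 5, 7»; census 1 718 / 1 718 optimal = unstarred incl. the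
(5; II/II*) corner 771 / 771). Replaces v10–v12's `stub_acrossIsogeny57` = E-imc-5(5) ∧ E-imc-5(7): K15a is WEAKER (ψ §1,
`supersingularStrongIsUnstarred_of_acrossIsogeny_of_gealyKlagsbrun`: K15a ⟸ modularity ∧ Gealy–Klagsbrun ∧ E-imc-5(5,7)) and is what
the composition consumes — CORNER(5; II) (`cornerTypeIIAtFive_of_strongIsUnstarred`) and the starred residue rows (5;8), (7;9)
(`coreRED57starred_of_twistFamilyItems`). OPEN; owned there; Manin-free, degree-free; beyond print at additive `p`
(Stevens 1989 §2; Vatsal 2005 / Byeon–Yhee 2013 are semistable). [cite: Stevens1989, §2] [cite: GealyKlagsbrun2017, Thm. 1] -/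
theorem stub_strongIsUnstarred57 :
    Summit.BirchSwinnertonDyer.BirchSwinnertonDyer.Theses.TwistFamilyManinDescent.SupersingularStrongIsUnstarred := by
  sorry

/-- STUB C2(13) (v13) — **TFMD's LINE-12/14 item BY NAME** (`TwistFamilyManinDescent.EisensteinOrdinaryStrongIsTop`,
stmt-BirchSwinnertonDyer-26929): for the `X₀`-optimal `W` at `p = 13`, additive, `E[13]` reducible, (G)-ordinary, every
globally minimal `W′` and `μ ∈ ℚ` with `13·L′ ⊊ μ·Λ_W ⊊ L′` has `v₁₃(μ) = 0` — the `13`-isogeny OUT of the optimal curve is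
ÉTALE (Stevens' conjecture at 13, transplanted to `13² ∣ N`; ecdata 22/22, kit j302458 232/232). Used in the MIDDLE
configuration of the trichotomy (optimality flips across `⊗ χ₁₃`; the Néron scalar of the isogeny from the optimal twin to
`W ⊗ 13*` is then `c/c′`). OPEN; owned there; beyond print (Vatsal 2005 Thms 1.10–1.11 are semistable / ordinary-at-ℓ).
[cite: Stevens1989, Thm. 2.3] [cite: Vatsal2005, Thms. 1.10–1.11] -/
theorem stub_strongIsTop13 :
    Summit.BirchSwinnertonDyer.BirchSwinnertonDyer.Theses.TwistFamilyManinDescent.EisensteinOrdinaryStrongIsTop := by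
  sorry


/-- COMPOSITION (v4; sorry-free outside the seven stubs): crux C5 `ManinPrimeToAdditiveFiveLe` BY NAME through the record's (v16) assembly
`maninPrimeToAdditiveFiveLe_of_fourPrints_of_sevenLeaves` (width seat -w2, `Theorems/…LedgerFourPrintsNoDD.lean`, p640646) — the four prints, K15a, K15b,
I9, K18a″, C2 as stubs BY NAME, and the two NOT-BOTTOM leaves as THEOREMS of this line: K18b″ = `stub_notBottom_of_horocyclic57 horocyclic57`,
C1 = `notBottom13`. -/
theorem ManinPrimeToAdditiveFiveLe_of :
    Summit.BirchSwinnertonDyer.BirchSwinnertonDyer.Theses.ManinLocalTwoThree.ManinPrimeToAdditiveFiveLe :=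
  maninPrimeToAdditiveFiveLe_of_fourPrints_of_sevenLeaves stub_printedInputs.1 stub_printedInputs.2.1 stub_printedInputs.2.2.1
    stub_printedInputs.2.2.2 stub_strongIsUnstarred57 stub_ss57 stub_deepInputs18R.1 stub_deepInputs18R.2
    (stub_notBottom_of_horocyclic57 horocyclic57) notBottom13 stub_strongIsTop13

/-- The ALTERNATIVE BOOK at 13 (the record's theorem, re-keyed to this line's `ord57_of_horocyclic`): with the imc cell's E-imc-9
`OrdinaryRamifiedTwistLaw 13` in place of C1 ∧ C2 the composition needs the same four prints (width seat -w4,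
`maninPrimeToAdditiveFiveLe_of_fourPrints_of_twistFamilyItems_of_ordinaryTwistLaw`, p636120). [cite: EdixhovenManin1991, Thm. 3] -/
theorem ManinPrimeToAdditiveFiveLe_of_ordinaryTwistLaw13 (hO13 : OrdinaryRamifiedTwistLaw 13) :
    Summit.BirchSwinnertonDyer.BirchSwinnertonDyer.Theses.ManinLocalTwoThree.ManinPrimeToAdditiveFiveLe :=
  maninPrimeToAdditiveFiveLe_of_fourPrints_of_twistFamilyItems_of_ordinaryTwistLaw stub_printedInputs.1 stub_printedInputs.2.1
    stub_printedInputs.2.2.1 stub_printedInputs.2.2.2 stub_ss57 ord57_of_horocyclic stub_strongIsUnstarred57 hO13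

end Summit.BirchSwinnertonDyer.BirchSwinnertonDyer.Cruxes.ManinPrimeToAdditiveFiveLe.HorocyclicOrientation

end
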